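import Literature.AlgebraicGeometry.Motives.HodgeStructure
import HarnessLib

/-!
# Pure `ℚ`-Hodge structures: strictness of morphisms (proofs for `HodgeStructure`)

This file discharges the named fact `Literature.AlgebraicGeometry.Motives.HodgeStructure.Hom.strict` of
`Literature/AlgebraicGeometry/Motives/HodgeStructure.lean`: a morphism `f : H₁ → H₂` of pure
`ℚ`-Hodge structures of the same weight `n` is **strict** for the Hodge filtration,
`f(F^p V₁) = F^p V₂ ∩ im f` for all `p` (Deligne, *Théorie de Hodge II*, Thm. 2.3.5 (iii): every
morphism of mixed Hodge structures is strictly compatible with the weight and Hodge filtrations —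
a Hodge structure of weight `n` being a mixed Hodge structure with trivial weight filtration — and
its abstract form Thm. 1.2.10 (iii) for opposed filtrations; "strict" in the sense of Hodge II,
1.1.5: `f(F^p A) = f(A) ∩ F^p B`).

## Proof

In the pure case no Hodge decomposition is needed, only the `n`-opposedness
`F^p ⊕ conj F^q = V_ℂ` (`p + q = n + 1`, the field `isCompl_F_complexConj`, Hodge II 1.2.5) of the
source *and* of the target, at the index `(p, n + 1 - p)`, together with the fact that the
complexification of `f` commutes with complex conjugation (`conj_baseChange`), so that `f` also
preserves the conjugate filtration (`Hom.map_complexConj_F_le`). Given `y = f x ∈ F^p V₂`, split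
`x = a + b` with `a ∈ F^p V₁` and `b ∈ conj F^{n+1-p} V₁`; then `f b = y - f a ∈ F^p V₂` and
`f b ∈ conj F^{n+1-p} V₂`, whence `f b ∈ F^p V₂ ∩ conj F^{n+1-p} V₂ = 0` and `y = f a ∈ f(F^p V₁)`.
The inclusion `f(F^p V₁) ⊆ F^p V₂ ∩ im f` is the definition of a morphism (`Hom.map_F_le`).

## Main results

* `Literature.AlgebraicGeometry.Motives.HodgeStructure.Hom.map_complexConj_F_le`: a morphism maps `conj F^q V₁` into `conj F^q V₂`.
* `Literature.HodgeStructure.Hom.strict_holds : Hom.strict`: the discharge.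

## References

* P. Deligne, *Théorie de Hodge. II*, Publ. Math. IHÉS 40 (1971), 5–57: 1.1.5 (strict morphisms),
  Prop. 1.2.5 (opposed filtrations), Thm. 1.2.10 (iii), Thm. 2.3.5 (iii).
* E. Cattani, F. El Zein, P. A. Griffiths, Lê D. T. (eds.), *Hodge Theory*, Princeton Math. Notes
  49 (2014), Ch. 3 (El Zein–Lê): Def. 3.2.3 (p. 153, strict: `f(F^n A) = f(A) ∩ F^n B`),
  Prop. 3.2.10 (p. 156, `F`, `G` `n`-opposite iff `F^p ⊕ G^q = A` for `p + q = n + 1`),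
  §3.2.2.2 (p. 158, morphisms are compatible with `conj F`), Cor. 3.2.21 (i) (p. 161) and
  Thm. 3.2.22 (iii) with Ex. 3.2.23 (1) (p. 162) (strictness; pure HS = MHS with trivial `W`).
* J. Carlson, S. Müller-Stach, C. Peters, *Period Mappings and Period Domains*, 2nd ed. (2017),
  p. 112 (strictness of morphisms; "the original source is Deligne (1971b)").
-/

open scoped TensorProduct

noncomputable section

namespace Literature.AlgebraicGeometry.Motives

namespace HodgeStructure

namespace Hom

universe u v

variable {V : Type u} [AddCommGroup V] [Module ℚ V]
variable {W : Type v} [AddCommGroup W] [Module ℚ W]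
variable {n : ℤ}

/-- A morphism of Hodge structures maps `conj F^q V₁` into `conj F^q V₂`: its complexification
commutes with complex conjugation (`conj_baseChange`) and preserves `F^q`
(Cattani–El Zein–Griffiths–Lê, *Hodge Theory*, §3.2.2.2, p. 158: a morphism compatible with the
filtration `F` "is also compatible with `conj F`"). [cite: CattaniElZeinGriffithsLe2014, §3.2.2.2 p. 158] -/
theorem map_complexConj_F_le {H₁ : HodgeStructure V n} {H₂ : HodgeStructure W n} (f : Hom H₁ H₂)
    (q : ℤ) : (complexConj (H₁.F q)).map (f.toLinearMap.baseChange ℂ) ≤ complexConj (H₂.F q) := by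
  rintro _ ⟨x, hx, rfl⟩
  rw [mem_complexConj, conj_baseChange]
  exact f.map_F_le q ⟨conj x, hx, rfl⟩

/-- **Morphisms of pure Hodge structures are strict**, discharging the named fact `Hom.strict`:
`f(F^p V₁) = F^p V₂ ∩ im f` for every morphism `f : H₁ → H₂` of weight-`n` Hodge structures and
every `p` (Deligne, *Théorie de Hodge II*, Thm. 2.3.5 (iii), with Thm. 1.2.10 (iii) its abstract
form for opposed filtrations and 1.1.5 the definition of "strict"; held restatements:
Cattani–El Zein–Griffiths–Lê, *Hodge Theory*, Def. 3.2.3 p. 153, Prop. 3.2.10 p. 156,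
Cor. 3.2.21 (i) p. 161, Thm. 3.2.22 (iii) and Ex. 3.2.23 (1) p. 162).

Proof: the pure case uses only the `n`-opposedness `isCompl_F_complexConj` of source and target at
`(p, n + 1 - p)`: if `y = f x ∈ F^p V₂`, split `x = a + b` with `a ∈ F^p V₁`,
`b ∈ conj F^{n+1-p} V₁`; then `f b = y - f a ∈ F^p V₂` and `f b ∈ conj F^{n+1-p} V₂`
(`map_complexConj_F_le`), so `f b ∈ F^p V₂ ⊓ conj F^{n+1-p} V₂ = ⊥`, i.e. `f b = 0` and
`y = f a ∈ f(F^p V₁)`. The inclusion `≤` is `map_F_le` and `map_le_range`.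
[cite: DeligneHodgeII1971, Thm. 2.3.5(iii) and Thm. 1.2.10(iii)] -/
theorem strict_holds : strict (V := V) (W := W) (n := n) := by
  intro H₁ H₂ f p
  refine le_antisymm (le_inf (f.map_F_le p) LinearMap.map_le_range) ?_
  rintro y ⟨hy, x, rfl⟩
  have hpq : p + (n + 1 - p) = n + 1 := by ring
  have hx : x ∈ H₁.F p ⊔ complexConj (H₁.F (n + 1 - p)) := by
    rw [(H₁.isCompl_F_complexConj p (n + 1 - p) hpq).sup_eq_top]
    exact Submodule.mem_top
  obtain ⟨a, ha, b, hb, rfl⟩ := Submodule.mem_sup.1 hx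
  have hfa : f.toLinearMap.baseChange ℂ a ∈ H₂.F p := f.map_F_le p ⟨a, ha, rfl⟩
  have hfb : f.toLinearMap.baseChange ℂ b ∈ complexConj (H₂.F (n + 1 - p)) :=
    f.map_complexConj_F_le (n + 1 - p) ⟨b, hb, rfl⟩
  have hfb' : f.toLinearMap.baseChange ℂ b ∈ H₂.F p := by
    have h := (H₂.F p).sub_mem hy hfa
    rwa [map_add, add_sub_cancel_left] at h
  have hb0 : f.toLinearMap.baseChange ℂ b = 0 := by
    rw [← Submodule.mem_bot ℂ, ← (H₂.isCompl_F_complexConj p (n + 1 - p) hpq).inf_eq_bot]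
    exact ⟨hfb', hfb⟩
  exact ⟨a, ha, by rw [map_add, hb0, add_zero]⟩

end Hom

end HodgeStructure

end Literature.AlgebraicGeometry.Motives

end
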